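import Summits.HodgeConjecture.HodgeConjecture.Theses.CurveNetMordellWeil
import Summits.HodgeConjecture.HodgeConjecture.Theorems.CurveNetMordellWeilComplexOrientationExists
import Summits.HodgeConjecture.HodgeConjecture.Theorems.CurveNetMordellWeilCurveNetExistsTransfer
import Literature.AlgebraicGeometry.HodgeTheory.SupportedHodgeClassDescent
import Literature.AlgebraicGeometry.HodgeTheory.ComplexConjugationHolds
import Literature.AlgebraicGeometry.Motives.CurveNetFromLemma411
import Literature.AlgebraicGeometry.HodgeTheory.SaitoGrFDeRhamCurveNet
import Literature.AlgebraicGeometry.HodgeTheory.GysinFormalismPushforward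
import Literature.AlgebraicGeometry.HodgeTheory.HodgeModelExistence
import Literature.AlgebraicTopology.SingularHomology.GysinMapSupportProofs

/-!
# Route CurveNetMordellWeil — crux `VerticalSupportMiddle`, line tangential-carriers-period-syzygies:
the stub `stub_steinFreeTransfer`, conditional on the route item `DeligneDescent`
(evidence for item stmt-HodgeConjecture-2782; helpers `--supports` it)

The line `tangential-carriers-period-syzygies` proves the crux `VerticalSupportMiddle` from three
stubs; the second is the STEIN-FREE TRANSFER

  `SteinFreeTransfer := OddConiveauOne → NetVerticality → GeneralVerticality`:

coniveau one for rational `(p,p)`-classes on smooth projective `(2p+1)`-folds (`p ≥ 1`) and vertical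
support for rational `(q,q)`-classes on the total spaces of honest curve nets
`N : Motives.CurveNet m X` (`m + 1 = 2q ≥ 4`: the class dies off `π⁻¹V(F)` for one non-zero form `F`)
imply vertical support for EVERY surjective `pr : X ⟶ ℙᵐ` on a smooth projective `2q`-fold `X`
(the class dies off `pr⁻¹T` for some Zariski-closed `T ⊊ ℙᵐ`). This file proves it — with the
three statements EXPANDED verbatim, since Theorems files cannot import the Cruxes/Lines module —
CONDITIONALLY on the route's own support item `DeligneDescent` (stmt-HodgeConjecture-2786, open in
the tree: `Theorems/CurveNetMordellWeilDeligneDescent` reduces it to the two Literature named facts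
`Deligne1974_ker_restrictCompl_eq_iSup_range_complexGysin`, `Voisin2025_hodgeClass_lift_complexGysin`).

## Proof (`steinFreeTransfer_of_deligneDescent`)

(i) `exists_restrictCompl_eq_zero_of_netVerticality`. `X` carries a curve net `N`
(`Motives.nonempty_curveNet_of_isAlgClosed`, de Jong 1996 Lemma 4.11); `σ^* c` is rational
(`IsRationalClass.pullback`) of type `(q,q)` (`IsOfHodgeType.map_of_le`, Hodge model from
`nonempty_hodgeModel_holds`), so by net verticality it dies off `W = π⁻¹V(F)`, `F ≠ 0`; hence
`σ_* σ^* c = t • c`, `t ≠ 0` (`exists_complexGysin_blowDown_map_eq_smul`) dies off the closed set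
`σ(W)` (Gysin maps are compatible with supports, `complexGysin_restrictCompl_eq_zero` over the
proved fact `gysinMap_restrictCompl_eq_zero_of_field ℂ`), and `σ(W) ≠ X`: `W ≠ X̃` because `π` is
onto and `V(F) ≠ ℙᵐ`, so the points of `W`, hence of `σ(W)`, have codimension `≥ 1`
(`one_le_coheight_of_mem_of_isClosed`, `le_coheight_of_mem_image`), unlike the generic point.
(ii) `DeligneDescent` with `Y = σ(W)`: `c` lies in the span of Gysin images `g_* b`, `g : W' ⟶ X`,
`dim W' = 2q − e`, `e ≥ 1`, `b` rational of type `(q−e, q−e)`. The classes dying off `pr⁻¹T` for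
some closed `T ⊊ ℙᵐ` form a submodule (a union of two proper closed subsets of the irreducible `ℙᵐ`
is proper), so it suffices to treat one `g_* b`. If `e ≥ 2`, `T := pr(g(W'))` is closed (proper
maps) with points of codimension `≥ e − 1 ≥ 1`, and `g_* b` dies off `pr⁻¹T ⊇ g(W')`. If `e = 1`,
`dim W' = 2(q−1) + 1` and `b` is a rational `(q−1,q−1)`-class, so by coniveau one it dies off a
closed `Z ⊆ W'` of codimension `≥ 1`; `T := pr(g(Z))` is closed with points of codimension `≥ 1`,
and `g_* b` dies off `pr⁻¹T ⊇ g(Z)`.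

## References

* [DeligneHodgeIII1974] P. Deligne, Théorie de Hodge III, Publ. Math. IHÉS 44 (1974), Cor. 8.2.8.
* [FultonYoungTableaux1997] W. Fulton, Young Tableaux, CUP 1997, App. B §B.1 (6), §B.2 Exercise 5.
* [DeJong1996] A. J. de Jong, Smoothness, semi-stability and alterations, Publ. Math. IHÉS 83
  (1996), Lemma 4.11, 4.12.
* [Hartshorne1977] R. Hartshorne, Algebraic Geometry, II Ex. 3.20, II Cor. 4.8.
* [VoisinHodgeI2002] C. Voisin, Hodge Theory and Complex Algebraic Geometry I, §7.3.2.
-/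

noncomputable section

-- `Summit.HodgeConjecture.HodgeConjecture.Theorems` is the mandated namespace (single-problem summit:
-- Problem = Summit), which `linter.dupNamespace` flags on every declaration; the lakefile turns the
-- linter off tree-wide (weak option), restated here so stand-alone elaboration is warning-free too.
set_option linter.dupNamespace false

open CategoryTheory AlgebraicGeometry
open Literature.AlgebraicGeometry Literature.AlgebraicGeometry.Motives
  Literature.AlgebraicGeometry.HodgeTheory Literature.AlgebraicTopology.SingularHomology
open Summit.HodgeConjecture.HodgeConjecture.Theses.CurveNetMordellWeil (DeligneDescent)

namespace Summit.HodgeConjecture.HodgeConjecture.Theorems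

/-! ### Bookkeeping: proper closed subsets of an irreducible variety -/

/-- A subset of a smooth projective (irreducible) variety all of whose points have codimension
`≥ 1` is not everything: the generic point has codimension `0`. [folklore] -/
theorem ne_univ_of_forall_one_le_coheight {n : ℕ} {X : SchemeOver ℂ} (hX : IsSmoothProjective n X)
    {T : Set X.left} (h : ∀ z ∈ T, (1 : ℕ∞) ≤ Order.coheight z) : T ≠ Set.univ := by
  haveI := irreducibleSpace_of_isSmoothProjective' hX
  intro hT
  have h1 := h (genericPoint X.left) (hT ▸ Set.mem_univ _)
  have h0 : Order.coheight (genericPoint X.left) = 0 :=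
    Order.coheight_eq_zero.2 fun y _ ↦
      Scheme.le_iff_specializes.2 ((genericPoint_spec X.left).specializes (Set.mem_univ y))
  rw [h0] at h1
  exact one_ne_zero (nonpos_iff_eq_zero.1 h1)

/-- The union of two proper Zariski-closed subsets of a smooth projective (irreducible) variety is
proper: their points have codimension `≥ 1` (`one_le_coheight_of_mem_of_isClosed`), the generic
point has codimension `0`. [folklore] -/
theorem union_ne_univ_of_isClosed {n : ℕ} {X : SchemeOver ℂ} (hX : IsSmoothProjective n X)
    {T T' : Set X.left} (hT : IsClosed T) (hTne : T ≠ Set.univ) (hT' : IsClosed T')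
    (hT'ne : T' ≠ Set.univ) : T ∪ T' ≠ Set.univ := by
  refine ne_univ_of_forall_one_le_coheight hX ?_
  rintro z (hz | hz)
  exacts [one_le_coheight_of_mem_of_isClosed hX hT hTne hz,
    one_le_coheight_of_mem_of_isClosed hX hT' hT'ne hz]

/-- Every class dies off the whole variety: `(Y ∖ Y)(ℂ)` is empty, so its cohomology vanishes.
[folklore] -/
theorem restrictCompl_univ_eq_zero {Y : SchemeOver ℂ} {a : ℕ} (y : complexBetti Y a) :
    complexBetti.restrictCompl Y Set.univ a y = 0 := by
  haveI : IsEmpty (Motives.complexPointsCompl Y Set.univ) := ⟨fun P ↦ P.2 (Set.mem_univ _)⟩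
  haveI := ModuleCat.subsingleton_of_isZero
    (Motives.isZero_singularCohomology_of_isEmpty ℂ ℂ (E := Motives.complexPointsCompl Y Set.univ) a)
  exact Subsingleton.elim _ _

/-! ### (i) A rational `(q,q)`-class on a `2q`-fold dies off a proper closed subset -/

/-- **Net verticality ⟹ coniveau one on `2q`-folds.** Granted vertical support on honest curve
nets (the hypothesis `h2`, the line's `NetVerticality` expanded), every rational `(q,q)`-class `c`
on a smooth projective `X` of dimension `2q = m + 1 ≥ 4` dies off a proper Zariski-closed subset:
`X` carries a curve net `N` (de Jong 1996, Lemma 4.11), `σ^* c` is a rational `(q,q)`-class on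
`X̃`, hence dies off `W = π⁻¹V(F)`, `F ≠ 0`, and `t • c = σ_* σ^* c` (`t ≠ 0`, projection formula)
dies off the proper closed subset `σ(W)` (Gysin maps are compatible with supports).
[cite: FultonYoungTableaux1997, Appendix B §B.1 (6) and §B.2 Exercise 5]
[cite: DeJong1996, Lemma 4.11 and 4.12] [cite: VoisinHodgeI2002, §7.3.2] -/
theorem exists_restrictCompl_eq_zero_of_netVerticality
    (h2 : ∀ ⦃q m : ℕ⦄ ⦃X : SchemeOver ℂ⦄ (N : CurveNet m X), 2 ≤ q → m + 1 = 2 * q →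
      ∀ c : complexBetti N.total (2 * q), IsRationalClass c →
        IsOfHodgeType (m + 1) N.total (2 * q) q q c →
          ∃ F : MvPolynomial (Fin (m + 1)) ℂ, F ≠ 0 ∧
            c ∈ classesSupportedOn N.total (N.proj.left.base ⁻¹' projHypersurface m F) (2 * q))
    {q m : ℕ} {X : SchemeOver ℂ} (hX : IsSmoothProjective (2 * q) X) (hq : 2 ≤ q)
    (hm : m + 1 = 2 * q) (c : complexBetti X (2 * q)) (hc : IsRationalClass c)
    (hh : IsOfHodgeType (2 * q) X (2 * q) q q c) :
    ∃ Y : Set X.left, IsClosed Y ∧ Y ≠ Set.univ ∧ complexBetti.restrictCompl X Y (2 * q) c = 0 := by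
  obtain ⟨μ, hμ⟩ := complexOrientationExists_proof
  have hS := gysinMap_restrictCompl_eq_zero_of_field.{0, 0} ℂ
  -- read the dimension of `X` as `m + 1`
  have hX' : IsSmoothProjective (m + 1) X := by rw [hm]; exact hX
  have hh' : IsOfHodgeType (m + 1) X (2 * q) q q c := by rw [hm]; exact hh
  -- a curve net on `X` and a Hodge model of its total space
  obtain ⟨N⟩ := nonempty_curveNet_of_isAlgClosed hX'
  obtain ⟨B⟩ := nonempty_hodgeModel.nonempty nonempty_hodgeModel_holds N.isSmoothProjective_total
  -- `σ^* c` is a rational `(q,q)`-class, hence vertical over some hypersurface `V(F)`, `F ≠ 0`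
  have hc'rat : IsRationalClass (complexBetti.map N.blowDown (2 * q) c) := hc.pullback _
  have hc'typ : IsOfHodgeType (m + 1) N.total (2 * q) q q (complexBetti.map N.blowDown (2 * q) c) :=
    hh'.map_of_le N.isSmoothProjective_total hX' B N.blowDown le_rfl
  obtain ⟨F, hF0, hcF⟩ := h2 N hq hm _ hc'rat hc'typ
  rw [mem_classesSupportedOn_iff] at hcF
  -- the vertical divisor `W = π⁻¹V(F)` is a proper closed subset of `X̃`
  have hWc : IsClosed (N.proj.left.base ⁻¹' projHypersurface m F) :=
    isClosed_preimage_projHypersurface N F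
  have hWne : N.proj.left.base ⁻¹' projHypersurface m F ≠ Set.univ := by
    intro hWu
    apply projHypersurface_ne_univ m hF0
    refine Set.eq_univ_of_forall fun b ↦ ?_
    obtain ⟨x, rfl⟩ := N.surjective_proj b
    have hx : x ∈ N.proj.left.base ⁻¹' projHypersurface m F := hWu ▸ Set.mem_univ x
    exact hx
  -- `σ` is proper, hence a closed map
  have hσ : IsClosedMap N.blowDown.left.base :=
    haveI := isProper_left_of_isSmoothProjective N.isSmoothProjective_total hX' N.blowDown
    N.blowDown.left.isClosedMap
  refine ⟨N.blowDown.left.base '' (N.proj.left.base ⁻¹' projHypersurface m F), hσ _ hWc, ?_, ?_⟩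
  · -- `σ(W) ≠ X`: its points have codimension `≥ 1`
    refine ne_univ_of_forall_one_le_coheight hX' fun x hx ↦ ?_
    exact le_coheight_of_mem_image N.isSmoothProjective_total hX' N.blowDown hσ (r := 1) (s := 1)
      (fun y hy ↦ one_le_coheight_of_mem_of_isClosed N.isSmoothProjective_total hWc hWne hy)
      (by omega) hx
  · -- `t • c = σ_* σ^* c` dies off `σ(W)`
    obtain ⟨t, ht, htc⟩ := exists_complexGysin_blowDown_map_eq_smul hμ N hX'
    have h0 := complexGysin_restrictCompl_eq_zero hS μ hμ N.isSmoothProjective_total hX' N.blowDown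
      (rfl : 2 * q + 2 * (m + 1) = 2 * q + 2 * (m + 1)) (hσ _ hWc)
      (complexBetti.map N.blowDown (2 * q) c)
      (complexBetti.restrictCompl_eq_zero_of_subset (Set.subset_preimage_image _ _) hcF)
    rw [htc (2 * q) c, map_smul] at h0
    exact (smul_eq_zero.1 h0).resolve_left ht

/-! ### (ii) The transfer -/

/-- **The Stein-free transfer, conditional on `DeligneDescent`** (registered stub
`stub_steinFreeTransfer` of the line `tangential-carriers-period-syzygies` for the crux
`CurveNetMordellWeil.VerticalSupportMiddle`, with `OddConiveauOne`, `NetVerticality`,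
`GeneralVerticality` expanded verbatim): granted Deligne descent (route item, hypothesis), coniveau
one for rational `(p,p)`-classes on smooth projective `(2p+1)`-folds (`p ≥ 1`) and vertical support
on honest curve nets imply that for every smooth projective `X` of dimension `2q = m + 1 ≥ 4`, every
SURJECTIVE `pr : X ⟶ ℙᵐ` and every rational `(q,q)`-class `c` on `X` there is a Zariski-closed
`T ⊊ ℙᵐ` with `c` dying off `pr⁻¹T`. Proof in the module docstring: `c` dies off a proper closed
`Y ⊆ X` (`exists_restrictCompl_eq_zero_of_netVerticality`); by descent `c = Σ g_* b` with `b`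
rational `(q−e,q−e)` on `W'` of dimension `2q − e`; for `e ≥ 2` take `T = pr(g(W'))`, for `e = 1`
take `T = pr(g(Z))` with `Z ⊊ W'` the support given by coniveau one; in both cases the points of
`T` have codimension `≥ 1` and `g_* b` dies off `pr⁻¹T`. [cite: DeligneHodgeIII1974, Cor. 8.2.8]
[cite: FultonYoungTableaux1997, Appendix B §B.2 Exercise 5] [cite: Hartshorne1977, II Ex. 3.20] -/
theorem steinFreeTransfer_of_deligneDescent :
    DeligneDescent →
    (∀ ⦃p : ℕ⦄ ⦃B : SchemeOver ℂ⦄, 1 ≤ p → IsSmoothProjective (2 * p + 1) B →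
      ∀ c : complexBetti B (2 * p), IsRationalClass c → IsOfHodgeType (2 * p + 1) B (2 * p) p p c →
        c ∈ supportedClasses B (2 * p) 1) →
    (∀ ⦃q m : ℕ⦄ ⦃X : SchemeOver ℂ⦄ (N : CurveNet m X), 2 ≤ q → m + 1 = 2 * q →
      ∀ c : complexBetti N.total (2 * q), IsRationalClass c →
        IsOfHodgeType (m + 1) N.total (2 * q) q q c →
          ∃ F : MvPolynomial (Fin (m + 1)) ℂ, F ≠ 0 ∧
            c ∈ classesSupportedOn N.total (N.proj.left.base ⁻¹' projHypersurface m F) (2 * q)) →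
    ∀ ⦃q m : ℕ⦄ ⦃X : SchemeOver ℂ⦄ (pr : X ⟶ projectiveSpace m ℂ), IsSmoothProjective (2 * q) X →
      2 ≤ q → m + 1 = 2 * q → Function.Surjective pr.left.base →
        ∀ c : complexBetti X (2 * q), IsRationalClass c → IsOfHodgeType (2 * q) X (2 * q) q q c →
          ∃ T : Set (projectiveSpace m ℂ).left, IsClosed T ∧ T ≠ Set.univ ∧
            complexBetti.restrictCompl X (pr.left.base ⁻¹' T) (2 * q) c = 0 := by
  intro hD h1 h2 q m X pr hX hq hm _hsurj c hc hh
  obtain ⟨μ, hμ⟩ := complexOrientationExists_proof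
  have hS := gysinMap_restrictCompl_eq_zero_of_field.{0, 0} ℂ
  have hP : IsSmoothProjective m (projectiveSpace m ℂ) := isSmoothProjective_projectiveSpace_holds ℂ m
  haveI : Nonempty (projectiveSpace m ℂ).left := by
    haveI := irreducibleSpace_of_isSmoothProjective' hP
    infer_instance
  -- (i) `c` dies off a proper closed subset `Y ⊆ X`
  obtain ⟨Y, hY, hYne, hcY⟩ := exists_restrictCompl_eq_zero_of_netVerticality h2 hX hq hm c hc hh
  -- (ii) Deligne descent: `c` is a sum of Gysin images of Hodge classes in lower dimension
  have hmem := hD μ hμ hX Y hY hYne c hc hh hcY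
  -- the `pr`-vertical classes form a submodule
  let S : Submodule ℂ (complexBetti X (2 * q)) :=
    { carrier := {x | ∃ T : Set (projectiveSpace m ℂ).left, IsClosed T ∧ T ≠ Set.univ ∧
        complexBetti.restrictCompl X (pr.left.base ⁻¹' T) (2 * q) x = 0}
      zero_mem' := ⟨∅, isClosed_empty, Set.empty_ne_univ, map_zero _⟩
      add_mem' := by
        rintro a b ⟨T, hT, hTne, ha⟩ ⟨T', hT', hT'ne, hb⟩
        refine ⟨T ∪ T', hT.union hT', union_ne_univ_of_isClosed hP hT hTne hT' hT'ne, ?_⟩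
        rw [map_add, complexBetti.restrictCompl_eq_zero_of_subset
            (Set.preimage_mono Set.subset_union_left) ha,
          complexBetti.restrictCompl_eq_zero_of_subset
            (Set.preimage_mono Set.subset_union_right) hb, add_zero]
      smul_mem' := by
        rintro r a ⟨T, hT, hTne, ha⟩
        exact ⟨T, hT, hTne, by rw [map_smul, ha, smul_zero]⟩ }
  change c ∈ S
  refine SetLike.le_def.mp ?_ hmem
  refine iSup_le fun d ↦ iSup_le fun e ↦ iSup_le fun hde ↦ iSup_le fun he ↦ iSup_le fun W ↦
    iSup_le fun m' ↦ iSup_le fun hm' ↦ iSup_le fun hW ↦ iSup_le fun g ↦ ?_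
  rw [Submodule.map_le_iff_le_comap, Submodule.span_le]
  rintro b ⟨hb, hb'⟩
  rw [SetLike.mem_coe, Submodule.mem_comap]
  -- `f = g ≫ pr : W ⟶ ℙᵐ` is proper, hence closed
  have hf : IsClosedMap (g ≫ pr).left.base :=
    haveI := isProper_left_of_isSmoothProjective hW hP (g ≫ pr)
    (g ≫ pr).left.isClosedMap
  have hfapp : ∀ w, (g ≫ pr).left.base w = pr.left.base (g.left.base w) := fun w ↦ by
    rw [Over.comp_left, Scheme.Hom.comp_apply]
  rcases Nat.lt_or_ge e 2 with he1 | he2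
  · -- `e = 1`: `dim W = 2(q-1) + 1`, `b` a rational `(q-1,q-1)`-class: coniveau one
    obtain rfl : e = 1 := by omega
    obtain rfl : m' = 2 * d + 1 := by omega
    have hd : 1 ≤ d := by omega
    obtain ⟨Z, hZ, hZ1, hbZ⟩ := exists_isClosed_of_mem_supportedClasses (h1 hd hW b hb hb')
    refine ⟨(g ≫ pr).left.base '' Z, hf _ hZ, ?_, ?_⟩
    · exact ne_univ_of_forall_one_le_coheight hP fun z hz ↦
        le_coheight_of_mem_image hW hP (g ≫ pr) hf hZ1 (s := 1) (by omega) hz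
    · refine complexGysin_restrictCompl_eq_zero hS μ hμ hW hX g _
        ((hf _ hZ).preimage pr.left.base.hom.continuous) b
        (complexBetti.restrictCompl_eq_zero_of_subset (fun z hz ↦ ?_) hbZ)
      exact ⟨z, hz, hfapp z⟩
  · -- `e ≥ 2`: `pr(g(W))` is a proper closed subset of `ℙᵐ`
    refine ⟨Set.range (g ≫ pr).left.base, hf.isClosed_range, ?_, ?_⟩
    · refine ne_univ_of_forall_one_le_coheight hP fun z hz ↦ ?_
      rw [← Set.image_univ] at hz
      exact le_coheight_of_mem_image hW hP (g ≫ pr) hf (S := Set.univ) (r := 0) (s := 1)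
        (fun _ _ ↦ by simp) (by omega) hz
    · refine complexGysin_restrictCompl_eq_zero hS μ hμ hW hX g _
        (hf.isClosed_range.preimage pr.left.base.hom.continuous) b ?_
      have huniv : g.left.base ⁻¹' (pr.left.base ⁻¹' Set.range (g ≫ pr).left.base) = Set.univ :=
        Set.eq_univ_of_forall fun w ↦ ⟨w, hfapp w⟩
      rw [huniv]
      exact restrictCompl_univ_eq_zero b

end Summit.HodgeConjecture.HodgeConjecture.Theorems

end
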